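import Mathlib
import HarnessLib
import HarnessLib.Audit
import Summits.Langlands.Statement
import Summits.Langlands.Langlands.Theses.SeedParityLadder
import Summits.Langlands.Langlands.Theses.PolyhedralTypeLadder

/-!
# PolyhedralTypeLadderCells — TREE TWIN (cells + kernels) of the lens-1-g21 node `PolyhedralTypeLadder` (decomp-langlands, D-0171/D-0178)

This file is the node HOME/nodes/lens-1-g21-PolyhedralTypeLadder.lean re-namespaced under `Theorems.PolyhedralTypeLadderCells`, with `Iff.rfl` bridges to the BORN route
`Summits.Langlands.Langlands.Theses.PolyhedralTypeLadder` (route-Langlands-PolyhedralTypeLadder rev 0, `--refines route-Langlands-SeedParityLadder:MaassTypeSeedAvatars`):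
the member-level dial `SolvableArtinTypeUpToTwist` (solvable Artin type up to twist, graded by the degree of the solvable splitting field), the cells
SOLV / INSOL (texts = the born decls), the exactness kernel `maassTypeSeedAvatars_iff_cells`, the rung ladder `DegRung`, necessity from the host and from
the summit, and `closes_root`.  Nothing here proves `Langlands`, MIX, SOLV or INSOL.  Original node docstring follows.

# lens-1-g21 NODE `PolyhedralTypeLadder` — child route of route-Langlands-SeedParityLadder (rev 0, DRAFT, my g19 lineage) at its declared-residual crux
# MIX = `Summit.Langlands.Langlands.Theses.SeedParityLadder.MaassTypeSeedAvatars` (stmt-Langlands-27036, crux rank 3, «RESIDUAL · IDEA-NEEDED», never split; tree text sha256/16 3cee2bbcf8c2e70a, 10991 chars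
# = QO `Summit.Langlands.Langlands.Theses.QuarterConductorLadder.OffQuarterBoxAvatars` (stmt-Langlands-26826, 8238 chars) + the two seed dials `¬HolSeedBox → SeedBox →`)

NODE (grading / quantitative-ladder lens, generation 21, 2026-08-31T01:20:00Z).  Seat planner-decomp-langlands-lens-1-g21; files nothing on the ledger
(crit-1 grades this node; writer-1 files; hands/census land Theorems files).  Kit: `HOME/nodes/lens-1-g21-PolyhedralTypeLadder.*`, memo `.md`, RUNME `.RUNME.md`.

## Licence for a hop below a declared residual (crit-1 row 239 rule i4: «next hop below MIX/REST needs an idea landing or an instrument verdict»)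
The instrument verdict is census I-L1g19.B (COSTUME-CENSUS-v22 H91; evidence `census/data/gen_v22/evidence/I-L1g19.md`, attached on stmt-Langlands-27035/27036):
MIX = MIX₀ (all weights k_β = 1: partially-odd / even ARTIN type — «dihedral sub-box PRINT, non-dihedral dark») ⊔ MIX₊ (≥ 1 place with k_β ≥ 2: conjecturally EMPTY,
undecided-with-test).  This node CASHES that verdict and ENLARGES its print sub-box from dihedral to the whole SOLVABLE polyhedral series: theorems stop exactly at S₄.

## The grading (Klein's ladder of finite subgroups of PGL₂(ℂ): cyclic ⊂ dihedral D_m ⊂ tetrahedral A₄ ⊂ octahedral S₄ ∣ icosahedral A₅)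
MIX says: every L-algebraic cuspidal π on GL_n/K in HULL₃ ∖ HULL₂, off the ℚ quarter box, with a totally-real non-regular GL₂ seed presentation (SeedBox: n = 2,
π ≅ BC_K(π₀) ⊗ χ a.e.) but NO holomorphic one, has semisimple ℓ-adic avatars.  The (A)-direction for such π is in print EXACTLY when π is, up to an algebraic twist,
of SOLVABLE ARTIN TYPE: Langlands–Tunnell bootstrapping (Langlands 1980 cyclic base change §3 + Tunnell 1981 + Jacquet–Shalika + the fibres of solvable base change,
Lapid–Rogawski 1998 / Rajan 2002) run DOWN a solvable tower produces the Artin representation σ with π ⊗ χ' = π(σ), and ι⁻¹σ^∨ ⊗ χ'_ℓ is the avatar.  The DIAL of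
this node is therefore the member-level, automorphic-intrinsic predicate
  D(π) = `SolvableArtinTypeUpToTwist K n hcpt π.1` := «∃ an algebraic Hecke character χ of K, a finite SOLVABLE GALOIS extension M/K and two FINITE-ORDER Hecke
  characters ψ₁, ψ₂ of M such that at almost every prime Q of M the f(Q|v)-th powers of the χ-twisted Satake parameters of π at v = Q ∩ K are {ψ₁(ϖ_Q), ψ₂(ϖ_Q)}»
  (= BC_M(π ⊗ χ) ≃ ψ₁ ⊞ ψ₂ a.e.; tree vocabulary only: `HeckeCharacter`, `.IsAlgebraic` (Weil type A₀), `.IsFiniteOrder`, `.valueAtUniformizer`, `HasSatakeParamAt`,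
  Mathlib `IsGalois`/`IsSolvable`/`Ideal.under`/`Ideal.inertiaDeg`; 719 chars).
Dictionary (under (A)): D(π) ⇔ the projective image Ḡ of the Galois type of π is a FINITE SOLVABLE subgroup of PGL₂ — the image of Γ_M in Ḡ is a normal CYCLIC subgroup N
(σ|Γ_M = ψ₁ ⊕ ψ₂) with Ḡ/N a quotient of Gal(M/K), and conversely N = 1, M ⊇ the projective splitting field works; icosahedral Ḡ = A₅ and non-Artin (infinite Ḡ) types
NEVER satisfy D, in any presentation, after any twist or any further solvable base change (A₅ has no proper solvable-index reduction: BC to a solvable Galois M keeps A₅).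
So the cut is ORBIT-CLOSED under the box symmetries (twist by algebraic GL₁ data: absorbed in χ; base change up a solvable K′/K: M′ = MK′) — not a K₀-costume.
GRADING g(π) = min [M:K] over dial witnesses (`SolvableArtinTypeUpToTwistLE d`, rung `DegRung d` = MIX on g ≤ d; `solvableArtinTypeAvatars_iff_forall_degRung`):
  · g = 1: vacuous for cuspidal π (Jacquet–Shalika: a cusp form is not Eisensteinian a.e.);
  · g = 2 (dihedral / monomial type, N = C_m ⊲ D_m): PRINT since Labesse–Langlands 1979 (π ⊗ χ = AI(ψ₁) = π(Ind ψ₁)) — the census's «dihedral sub-box»;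
  · g = 12 (tetrahedral: A₄ has no non-trivial normal cyclic subgroup, so M ⊇ the A₄-field), g = 24 (octahedral): PRINT by Langlands 1980 / Tunnell 1981 read downwards;
  · g = ∞ (no witness): icosahedral Artin type (even / mixed-sign A₅ quintic Hilbert weight-one forms: direction (A) OPEN — no Langlands–Tunnell, no Shimura realisation of a
    Maass-type component, no trace-formula census beyond ℚ), MIX₊ (a seed with some k_β ≥ 2 and a Maass-type weight-one place: conjecturally EMPTY — census I-L1g19.B) and
    non-Artin Galois type (conjecturally empty under (A)+Fontaine–Mazur, named fact HeckeCharacter.exists_lAdic_isDeRhamFramed's converse side): RESIDUAL · IDEA-NEEDED.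
Theorems stop EXACTLY at S₄ (solvable ⟂ A₅ simple): the ladder's ceiling is Klein's classification, a theorem (tree: `projectiveType_of_isIrreducible_of_isSolvable'`,
`isDihedralType_or_isTetrahedralType_or_isOctahedralType`, proved outright).

## Target ⟸ pieces   (EXACT: `maassTypeSeedAvatars_iff_cells : MIX ↔ SOLV ∧ INSOL`, one `Classical.em` on the dial; 0 EQUIV / 0 WLOG items; 0 sorry)
  MIX ⟸ SOLV `SolvableArtinTypeAvatars`    (crux 2 · MIX on members of solvable Artin type up to twist · WEAKER (kernel `solvableArtinTypeAvatars_of_host`) · PRINT / ATTACKABLE-NOW;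
                                          skeleton `birth_SOLV`: stub₁ `stub_solvableArtinDescent` (L; Langlands–Tunnell bootstrapping downwards) → stub₂ `stub_artinAvatarTransport` (M; tree-adjacent))
      ∧ INSOL `NonSolvableTypeSeedAvatars` (crux 3 · MIX on members NOT of solvable Artin type up to twist · WEAKER (`nonSolvableTypeSeedAvatars_of_host`) · DECLARED RESIDUAL: IDEA-NEEDED
                                          (icosahedral Galois type; the conjecturally-empty MIX₊ / non-Artin strata))
  S-implied: each piece ⟸ MIX ⟸ `Langlands` (kernels `…_of_host`, `maassTypeSeedAvatars_of_langlands` — direction (A) of the summit projected to its Satake clause).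
  Child `closes (hS : SOLV) (hI : INSOL) : Summit.Langlands.Langlands.Theses.SeedParityLadder.MaassTypeSeedAvatars` BY NAME (V-R, `--refines route-Langlands-SeedParityLadder:MaassTypeSeedAvatars`; crit row 247 n1 shape:
  no FRAME item, Assembly concludes MIX); ROOT: `closes_root` = the tree's `QuarterConductorLadder.closes` ∘ `SeedParityLadder.closes` with MIX rebuilt from the two cells.
  Each piece = the TREE text of MIX with ONE inserted hypothesis after the SeedBox clause (the dial / its negation, tree vocabulary only, full names):
  SOLV 11715 · INSOL 11717 chars (cap 12 000).
-/

set_option linter.dupNamespace false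
set_option linter.unusedVariables false

namespace Summit.Langlands.Langlands.Theorems.PolyhedralTypeLadderCells

open Summit.Langlands.Langlands.Theses

open scoped BigOperators Topology Manifold Classical MeasureTheory ProbabilityTheory Matrix InnerProductSpace ComplexConjugate ContinuousMap
open Filter Set Function TopologicalSpace MeasureTheory
open Literature.NumberTheory.Automorphic Literature.NumberTheory.GaloisRepresentations

/-! ## §1 The dial: solvable Artin type up to twist (member-level, automorphic-intrinsic); graded version `…LE d` ([M:K] ≤ d) -/

/-- `SolvableArtinTypeUpToTwist K n hcpt P`: there are an algebraic (type A₀) Hecke character `χ` of `K`, a finite solvable Galois extension `M/K` and two finite-order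
Hecke characters `ψ₁ ψ₂` of `M` such that for almost every prime `Q` of `M`, with `v = Q ∩ 𝓞_K` and `α` the Satake parameter of `P` at `v`:
`(α · χ(ϖ_v)) ^ f(Q|v) = {ψ₁(ϖ_Q), ψ₂(ϖ_Q)}` as multisets — i.e. `BC_M(P ⊗ χ) ≃ ψ₁ ⊞ ψ₂` almost everywhere.  Under reciprocity this says: the projective Galois
type of `P` is a finite solvable subgroup of `PGL₂` (cyclic, dihedral, `A₄`, `S₄`). -/
def SolvableArtinTypeUpToTwist (K : Type) [Field K] [NumberField K] (n : ℕ) (hcpt : Literature.NumberTheory.Automorphic.isCompact_glFiniteIntegralLevel n K) (P : Literature.NumberTheory.Automorphic.AutomorphicRepData (Literature.NumberTheory.Automorphic.AutomorphyDatum.gl n K hcpt)) : Prop :=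
  ∃ (χ : Literature.NumberTheory.GaloisRepresentations.HeckeCharacter K) (M : Type) (_ : Field M) (_ : NumberField M) (_ : Algebra K M) (ψ₁ ψ₂ : Literature.NumberTheory.GaloisRepresentations.HeckeCharacter M), IsGalois K M ∧ IsSolvable (M ≃ₐ[K] M) ∧ χ.IsAlgebraic ∧ ψ₁.IsFiniteOrder ∧ ψ₂.IsFiniteOrder ∧ ∀ᶠ Q : IsDedekindDomain.HeightOneSpectrum (NumberField.RingOfIntegers M) in cofinite, ∀ (v : IsDedekindDomain.HeightOneSpectrum (NumberField.RingOfIntegers K)) (α : Multiset ℂ), Q.asIdeal.under (NumberField.RingOfIntegers K) = v.asIdeal → P.HasSatakeParamAt v α → (α.map (χ.valueAtUniformizer v * ·)).map (· ^ Q.asIdeal.inertiaDeg (NumberField.RingOfIntegers K)) = {ψ₁.valueAtUniformizer Q, ψ₂.valueAtUniformizer Q}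

/-- `SolvableArtinTypeUpToTwistLE d K n hcpt P`: the same with a witness of degree `[M:K] ≤ d` (the grading: 2 = dihedral/monomial, 12 = tetrahedral, 24 = octahedral). -/
def SolvableArtinTypeUpToTwistLE (d : ℕ) (K : Type) [Field K] [NumberField K] (n : ℕ) (hcpt : Literature.NumberTheory.Automorphic.isCompact_glFiniteIntegralLevel n K) (P : Literature.NumberTheory.Automorphic.AutomorphicRepData (Literature.NumberTheory.Automorphic.AutomorphyDatum.gl n K hcpt)) : Prop :=
  ∃ (χ : Literature.NumberTheory.GaloisRepresentations.HeckeCharacter K) (M : Type) (_ : Field M) (_ : NumberField M) (_ : Algebra K M) (ψ₁ ψ₂ : Literature.NumberTheory.GaloisRepresentations.HeckeCharacter M), IsGalois K M ∧ IsSolvable (M ≃ₐ[K] M) ∧ Module.finrank K M ≤ d ∧ χ.IsAlgebraic ∧ ψ₁.IsFiniteOrder ∧ ψ₂.IsFiniteOrder ∧ ∀ᶠ Q : IsDedekindDomain.HeightOneSpectrum (NumberField.RingOfIntegers M) in cofinite, ∀ (v : IsDedekindDomain.HeightOneSpectrum (NumberField.RingOfIntegers K)) (α : Multiset ℂ), Q.asIdeal.under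 (NumberField.RingOfIntegers K) = v.asIdeal → P.HasSatakeParamAt v α → (α.map (χ.valueAtUniformizer v * ·)).map (· ^ Q.asIdeal.inertiaDeg (NumberField.RingOfIntegers K)) = {ψ₁.valueAtUniformizer Q, ψ₂.valueAtUniformizer Q}

/-- Rungs are monotone in the degree bound. -/
theorem solvableArtinTypeUpToTwistLE_mono {d d' : ℕ} (hdd : d ≤ d') {K : Type} [Field K] [NumberField K] {n : ℕ} {hcpt : Literature.NumberTheory.Automorphic.isCompact_glFiniteIntegralLevel n K} {P : Literature.NumberTheory.Automorphic.AutomorphicRepData (Literature.NumberTheory.Automorphic.AutomorphyDatum.gl n K hcpt)} :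
    SolvableArtinTypeUpToTwistLE d K n hcpt P → SolvableArtinTypeUpToTwistLE d' K n hcpt P := by
  rintro ⟨χ, M, _, _, _, ψ₁, ψ₂, hG, hS, hd, hχ, h₁, h₂, hrel⟩
  exact ⟨χ, M, _, _, _, ψ₁, ψ₂, hG, hS, hd.trans hdd, hχ, h₁, h₂, hrel⟩

/-- A bounded witness is a witness. -/
theorem solvableArtinTypeUpToTwist_of_le {d : ℕ} {K : Type} [Field K] [NumberField K] {n : ℕ} {hcpt : Literature.NumberTheory.Automorphic.isCompact_glFiniteIntegralLevel n K} {P : Literature.NumberTheory.Automorphic.AutomorphicRepData (Literature.NumberTheory.Automorphic.AutomorphyDatum.gl n K hcpt)} : SolvableArtinTypeUpToTwistLE d K n hcpt P → SolvableArtinTypeUpToTwist K n hcpt P := by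
  rintro ⟨χ, M, _, _, _, ψ₁, ψ₂, hG, hS, -, hχ, h₁, h₂, hrel⟩
  exact ⟨χ, M, _, _, _, ψ₁, ψ₂, hG, hS, hχ, h₁, h₂, hrel⟩

/-- The dial is the union of its rungs (every witness `M` has SOME degree). -/
theorem solvableArtinTypeUpToTwist_iff_exists_le {K : Type} [Field K] [NumberField K] {n : ℕ} {hcpt : Literature.NumberTheory.Automorphic.isCompact_glFiniteIntegralLevel n K} {P : Literature.NumberTheory.Automorphic.AutomorphicRepData (Literature.NumberTheory.Automorphic.AutomorphyDatum.gl n K hcpt)} :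
    SolvableArtinTypeUpToTwist K n hcpt P ↔ ∃ d, SolvableArtinTypeUpToTwistLE d K n hcpt P := by
  constructor
  · rintro ⟨χ, M, _, _, _, ψ₁, ψ₂, hG, hS, hχ, h₁, h₂, hrel⟩
    exact ⟨Module.finrank K M, χ, M, _, _, _, ψ₁, ψ₂, hG, hS, le_rfl, hχ, h₁, h₂, hrel⟩
  · rintro ⟨d, hd⟩
    exact solvableArtinTypeUpToTwist_of_le hd

/-! ## §2 The pieces (route items; texts = MIX verbatim + the dial hypothesis / its negation) -/

/-- SOLV · crux (rank 2) · PRINT / ATTACKABLE-NOW — MIX on members of solvable Artin type up to twist (dihedral, tetrahedral, octahedral). -/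
def SolvableArtinTypeAvatars : Prop :=
  ∀ (K : Type) [Field K] [NumberField K] (n : ℕ) (hcpt : Literature.NumberTheory.Automorphic.isCompact_glFiniteIntegralLevel n K), 0 < n → ∀ (π : Literature.NumberTheory.Automorphic.CuspidalAutomorphicRepData n K hcpt), π.1.IsLAlgebraic → ¬ (n = 2 ∧ ∃ (h₀ : Literature.NumberTheory.Automorphic.isCompact_glFiniteIntegralLevel 2 ℚ) (π₀ : Literature.NumberTheory.Automorphic.CuspidalAutomorphicRepData 2 ℚ h₀) (h₁ : Literature.NumberTheory.Automorphic.isCompact_glFiniteIntegralLevel 1 K) (χ : Literature.NumberTheory.Automorphic.AutomorphicRepData (Literature.NumberTheory.Automorphic.AutomorphyDatum.gl 1 K h₁)), π₀.1.HasArchParameter (fun _ => ({0, 0} : Multiset ℂ)) ∧ (∀ φ ∈ π₀.1.W, Literature.NumberTheory.Automorphic.rightTranslation (Literature.NumberTheory.Automorphic.AdelicGroupData.gl 2 ℚ) ((Literature.NumberTheory.Automorphic.AutomorphyDatum.gl 2 ℚ h₀).ofArch ⟨-1, trivial⟩) φ - φ ∈ π₀.1.W') ∧ χ.IsLAlgebraic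 ∧ ∀ᶠ w : IsDedekindDomain.HeightOneSpectrum (NumberField.RingOfIntegers K) in Filter.cofinite, ∀ (u : IsDedekindDomain.HeightOneSpectrum (NumberField.RingOfIntegers ℚ)) (α : Multiset ℂ) (c : ℂ), w.asIdeal.under (NumberField.RingOfIntegers ℚ) = u.asIdeal → π₀.1.HasSatakeParamAt u α → χ.HasSatakeParamAt w {c} → π.1.HasSatakeParamAt w ((α.map (· ^ w.asIdeal.inertiaDeg (NumberField.RingOfIntegers ℚ))).map (c * ·))) → ¬ (n = 2 ∧ ∃ (K₀ : Type) (_ : Field K₀) (_ : NumberField K₀) (_ : Algebra K₀ K), NumberField.IsTotallyReal K₀ ∧ ∃ (h₀ : Literature.NumberTheory.Automorphic.isCompact_glFiniteIntegralLevel 2 K₀) (π₀ : Literature.NumberTheory.Automorphic.CuspidalAutomorphicRepData 2 K₀ h₀) (k : (K₀ →+* ℂ) → ℕ) (w : ℤ) (h₁ : Literature.NumberTheory.Automorphic.isCompact_glFiniteIntegralLevel 1 K) (χ : Literature.NumberTheory.Automorphic.AutomorphicRepData (Literature.NumberTheory.Automorphic.AutomorphyDatum.gl 1 K h₁)), π₀.1.IsLAlgebraic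 ∧ π₀.1.HasInfinityType (Literature.NumberTheory.Automorphic.hilbertInfinityType k w) ∧ (∀ (u : NumberField.InfinitePlace K₀), ∀ φ ∈ π₀.1.W, Literature.NumberTheory.Automorphic.rightTranslation (Literature.NumberTheory.Automorphic.AdelicGroupData.gl 2 K₀) (Matrix.GeneralLinearGroup.scalar (Fin 2) (Units.map (MonoidHom.inl (NumberField.InfiniteAdeleRing K₀) (IsDedekindDomain.FiniteAdeleRing (NumberField.RingOfIntegers K₀) K₀) : NumberField.InfiniteAdeleRing K₀ →* NumberField.AdeleRing (NumberField.RingOfIntegers K₀) K₀) (Units.map (MonoidHom.mulSingle (fun u' : NumberField.InfinitePlace K₀ => u'.Completion) u : u.Completion →* NumberField.InfiniteAdeleRing K₀) (-1)))) φ + φ ∈ π₀.1.W') ∧ (∃ β : K₀ →+* ℂ, k β = 1) ∧ χ.IsLAlgebraic ∧ ∀ᶠ w : IsDedekindDomain.HeightOneSpectrum (NumberField.RingOfIntegers K) in Filter.cofinite, ∀ (u : IsDedekindDomain.HeightOneSpectrum (NumberField.RingOfIntegers K₀)) (α : Multiset ℂ) (c : ℂ), w.asIdeal.under (NumberField.RingOfIntegers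 K₀) = u.asIdeal → π₀.1.HasSatakeParamAt u α → χ.HasSatakeParamAt w {c} → π.1.HasSatakeParamAt w ((α.map (· ^ w.asIdeal.inertiaDeg (NumberField.RingOfIntegers K₀))).map (c * ·))) → (n = 2 ∧ ∃ (K₀ : Type) (_ : Field K₀) (_ : NumberField K₀) (_ : Algebra K₀ K), NumberField.IsTotallyReal K₀ ∧ ∃ (h₀ : Literature.NumberTheory.Automorphic.isCompact_glFiniteIntegralLevel 2 K₀) (π₀ : Literature.NumberTheory.Automorphic.CuspidalAutomorphicRepData 2 K₀ h₀) (k : (K₀ →+* ℂ) → ℕ) (w : ℤ) (h₁ : Literature.NumberTheory.Automorphic.isCompact_glFiniteIntegralLevel 1 K) (χ : Literature.NumberTheory.Automorphic.AutomorphicRepData (Literature.NumberTheory.Automorphic.AutomorphyDatum.gl 1 K h₁)), π₀.1.IsLAlgebraic ∧ π₀.1.HasInfinityType (Literature.NumberTheory.Automorphic.hilbertInfinityType k w) ∧ (∃ β : K₀ →+* ℂ, k β = 1) ∧ χ.IsLAlgebraic ∧ ∀ᶠ w : IsDedekindDomain.HeightOneSpectrum (NumberField.RingOfIntegers K) in Filter.cofinite,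 ∀ (u : IsDedekindDomain.HeightOneSpectrum (NumberField.RingOfIntegers K₀)) (α : Multiset ℂ) (c : ℂ), w.asIdeal.under (NumberField.RingOfIntegers K₀) = u.asIdeal → π₀.1.HasSatakeParamAt u α → χ.HasSatakeParamAt w {c} → π.1.HasSatakeParamAt w ((α.map (· ^ w.asIdeal.inertiaDeg (NumberField.RingOfIntegers K₀))).map (c * ·))) → (∃ (χ : Literature.NumberTheory.GaloisRepresentations.HeckeCharacter K) (M : Type) (_ : Field M) (_ : NumberField M) (_ : Algebra K M) (ψ₁ ψ₂ : Literature.NumberTheory.GaloisRepresentations.HeckeCharacter M), IsGalois K M ∧ IsSolvable (M ≃ₐ[K] M) ∧ χ.IsAlgebraic ∧ ψ₁.IsFiniteOrder ∧ ψ₂.IsFiniteOrder ∧ ∀ᶠ Q : IsDedekindDomain.HeightOneSpectrum (NumberField.RingOfIntegers M) in cofinite, ∀ (v : IsDedekindDomain.HeightOneSpectrum (NumberField.RingOfIntegers K)) (α : Multiset ℂ), Q.asIdeal.under (NumberField.RingOfIntegers K) = v.asIdeal → π.1.HasSatakeParamAt v α → (α.map (χ.valueAtUniformizer v * ·)).map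 (· ^ Q.asIdeal.inertiaDeg (NumberField.RingOfIntegers K)) = {ψ₁.valueAtUniformizer Q, ψ₂.valueAtUniformizer Q}) → ¬ (∀ S : (∀ (K : Type) [Field K] [NumberField K] (n : ℕ) (hcpt : Literature.NumberTheory.Automorphic.isCompact_glFiniteIntegralLevel n K), Literature.NumberTheory.Automorphic.AutomorphicRepData (Literature.NumberTheory.Automorphic.AutomorphyDatum.gl n K hcpt) → Prop), ((∀ (K : Type) [Field K] [NumberField K] (n : ℕ) (hcpt : Literature.NumberTheory.Automorphic.isCompact_glFiniteIntegralLevel n K) (π : Literature.NumberTheory.Automorphic.CuspidalAutomorphicRepData n K hcpt), 0 < n → π.1.IsLAlgebraic → (∃ (K₀ : Type) (_ : Field K₀) (_ : NumberField K₀) (_ : Algebra K₀ K), IsGalois K₀ K ∧ IsCyclic (K ≃ₐ[K₀] K) ∧ (NumberField.IsTotallyReal K₀ ∨ NumberField.IsCMField K₀) ∧ ∃ T : Literature.NumberTheory.Automorphic.InfinityType K n, π.1.HasInfinityType T ∧ (Literature.NumberTheory.Automorphic.InfinityType.automorphicInduction K₀ (n * Module.finrank K₀ K) T).IsRegular) →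 S K n hcpt π.1) ∧ (∀ (K₀ : Type) [Field K₀] [NumberField K₀] (M : Type) [Field M] [NumberField M] [Algebra K₀ M] (n : ℕ) (h₀ : Literature.NumberTheory.Automorphic.isCompact_glFiniteIntegralLevel n K₀) (hM : Literature.NumberTheory.Automorphic.isCompact_glFiniteIntegralLevel n M) (h₁ : Literature.NumberTheory.Automorphic.isCompact_glFiniteIntegralLevel 1 M) (π₀ : Literature.NumberTheory.Automorphic.CuspidalAutomorphicRepData n K₀ h₀) (χ : Literature.NumberTheory.Automorphic.AutomorphicRepData (Literature.NumberTheory.Automorphic.AutomorphyDatum.gl 1 M h₁)) (P : Literature.NumberTheory.Automorphic.AutomorphicRepData (Literature.NumberTheory.Automorphic.AutomorphyDatum.gl n M hM)), π₀.1.IsLAlgebraic → χ.IsLAlgebraic → (∀ᶠ w : IsDedekindDomain.HeightOneSpectrum (NumberField.RingOfIntegers M) in cofinite, ∀ (u : IsDedekindDomain.HeightOneSpectrum (NumberField.RingOfIntegers K₀)) (α : Multiset ℂ) (c : ℂ), w.asIdeal.under (NumberField.RingOfIntegers K₀) = u.asIdeal → π₀.1.HasSatakeParamAt u α → χ.HasSatakeParamAt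 w {c} → P.HasSatakeParamAt w ((α.map (· ^ w.asIdeal.inertiaDeg (NumberField.RingOfIntegers K₀))).map (c * ·))) → S K₀ n h₀ π₀.1 → S M n hM P) ∧ (∀ (K : Type) [Field K] [NumberField K] (L : Type) [Field L] [NumberField L] [Algebra K L] (m n : ℕ) (hL : Literature.NumberTheory.Automorphic.isCompact_glFiniteIntegralLevel m L) (hcpt : Literature.NumberTheory.Automorphic.isCompact_glFiniteIntegralLevel n K) (σ : Literature.NumberTheory.Automorphic.CuspidalAutomorphicRepData m L hL) (π : Literature.NumberTheory.Automorphic.AutomorphicRepData (Literature.NumberTheory.Automorphic.AutomorphyDatum.gl n K hcpt)), 0 < m → σ.1.IsLAlgebraic → (∀ᶠ v : IsDedekindDomain.HeightOneSpectrum (NumberField.RingOfIntegers K) in cofinite, ∀ β : IsDedekindDomain.HeightOneSpectrum (NumberField.RingOfIntegers L) → Multiset ℂ, (∀ w : IsDedekindDomain.HeightOneSpectrum (NumberField.RingOfIntegers L), w.asIdeal.under (NumberField.RingOfIntegers K) = v.asIdeal → σ.1.HasSatakeParamAt w (β w)) → ∃ α : Multiset ℂ, π.HasSatakeParamAt v α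 ∧ Literature.NumberTheory.Automorphic.satakePolynomial α = ∏ᶠ w ∈ {w : IsDedekindDomain.HeightOneSpectrum (NumberField.RingOfIntegers L) | w.asIdeal.under (NumberField.RingOfIntegers K) = v.asIdeal}, (Literature.NumberTheory.Automorphic.satakePolynomial (β w)).comp (Polynomial.X ^ w.asIdeal.inertiaDeg (NumberField.RingOfIntegers K))) → S L m hL σ.1 → S K n hcpt π)) → S K n hcpt π.1) → (∀ S : (∀ (K : Type) [Field K] [NumberField K] (n : ℕ) (hcpt : Literature.NumberTheory.Automorphic.isCompact_glFiniteIntegralLevel n K), Literature.NumberTheory.Automorphic.AutomorphicRepData (Literature.NumberTheory.Automorphic.AutomorphyDatum.gl n K hcpt) → Prop), ((∀ (K : Type) [Field K] [NumberField K] (n : ℕ) (hcpt : Literature.NumberTheory.Automorphic.isCompact_glFiniteIntegralLevel n K) (π : Literature.NumberTheory.Automorphic.CuspidalAutomorphicRepData n K hcpt), 0 < n → π.1.IsLAlgebraic → (∃ (K₀ : Type) (_ : Field K₀) (_ : NumberField K₀) (_ : Algebra K₀ K), IsGalois K₀ K ∧ IsCyclic (K ≃ₐ[K₀] K) ∧ (NumberField.IsTotallyReal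 K₀ ∨ NumberField.IsCMField K₀) ∧ ∃ T : Literature.NumberTheory.Automorphic.InfinityType K n, π.1.HasInfinityType T ∧ (Literature.NumberTheory.Automorphic.InfinityType.automorphicInduction K₀ (n * Module.finrank K₀ K) T).IsWeaklyRegular) → S K n hcpt π.1) ∧ (∀ (K₀ : Type) [Field K₀] [NumberField K₀] (M : Type) [Field M] [NumberField M] [Algebra K₀ M] (n : ℕ) (h₀ : Literature.NumberTheory.Automorphic.isCompact_glFiniteIntegralLevel n K₀) (hM : Literature.NumberTheory.Automorphic.isCompact_glFiniteIntegralLevel n M) (h₁ : Literature.NumberTheory.Automorphic.isCompact_glFiniteIntegralLevel 1 M) (π₀ : Literature.NumberTheory.Automorphic.CuspidalAutomorphicRepData n K₀ h₀) (χ : Literature.NumberTheory.Automorphic.AutomorphicRepData (Literature.NumberTheory.Automorphic.AutomorphyDatum.gl 1 M h₁)) (P : Literature.NumberTheory.Automorphic.AutomorphicRepData (Literature.NumberTheory.Automorphic.AutomorphyDatum.gl n M hM)), π₀.1.IsLAlgebraic → χ.IsLAlgebraic → (∀ᶠ w : IsDedekindDomain.HeightOneSpectrum (NumberField.RingOfIntegers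 M) in cofinite, ∀ (u : IsDedekindDomain.HeightOneSpectrum (NumberField.RingOfIntegers K₀)) (α : Multiset ℂ) (c : ℂ), w.asIdeal.under (NumberField.RingOfIntegers K₀) = u.asIdeal → π₀.1.HasSatakeParamAt u α → χ.HasSatakeParamAt w {c} → P.HasSatakeParamAt w ((α.map (· ^ w.asIdeal.inertiaDeg (NumberField.RingOfIntegers K₀))).map (c * ·))) → S K₀ n h₀ π₀.1 → S M n hM P) ∧ (∀ (K : Type) [Field K] [NumberField K] (L : Type) [Field L] [NumberField L] [Algebra K L] (m n : ℕ) (hL : Literature.NumberTheory.Automorphic.isCompact_glFiniteIntegralLevel m L) (hcpt : Literature.NumberTheory.Automorphic.isCompact_glFiniteIntegralLevel n K) (σ : Literature.NumberTheory.Automorphic.CuspidalAutomorphicRepData m L hL) (π : Literature.NumberTheory.Automorphic.AutomorphicRepData (Literature.NumberTheory.Automorphic.AutomorphyDatum.gl n K hcpt)), 0 < m → σ.1.IsLAlgebraic → (∀ᶠ v : IsDedekindDomain.HeightOneSpectrum (NumberField.RingOfIntegers K) in cofinite, ∀ β : IsDedekindDomain.HeightOneSpectrum (NumberField.RingOfIntegers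 L) → Multiset ℂ, (∀ w : IsDedekindDomain.HeightOneSpectrum (NumberField.RingOfIntegers L), w.asIdeal.under (NumberField.RingOfIntegers K) = v.asIdeal → σ.1.HasSatakeParamAt w (β w)) → ∃ α : Multiset ℂ, π.HasSatakeParamAt v α ∧ Literature.NumberTheory.Automorphic.satakePolynomial α = ∏ᶠ w ∈ {w : IsDedekindDomain.HeightOneSpectrum (NumberField.RingOfIntegers L) | w.asIdeal.under (NumberField.RingOfIntegers K) = v.asIdeal}, (Literature.NumberTheory.Automorphic.satakePolynomial (β w)).comp (Polynomial.X ^ w.asIdeal.inertiaDeg (NumberField.RingOfIntegers K))) → S L m hL σ.1 → S K n hcpt π)) → S K n hcpt π.1) → ∀ (ℓ : ℕ) [Fact ℓ.Prime] (ι : PadicAlgCl ℓ ≃+* ℂ), ∃ ρ : Literature.NumberTheory.GaloisRepresentations.FramedGaloisRep K (PadicAlgCl ℓ) n, ρ.toGaloisRep.IsSemisimple ∧ ∀ᶠ v : IsDedekindDomain.HeightOneSpectrum (NumberField.RingOfIntegers K) in Filter.cofinite, SatakeFrobCompatibleAt ι π.1 ρ v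

/-- INSOL · crux (rank 3) · DECLARED RESIDUAL (IDEA-NEEDED) — MIX on members NOT of solvable Artin type up to twist (icosahedral Galois type; conjecturally-empty MIX₊ / non-Artin strata). -/
def NonSolvableTypeSeedAvatars : Prop :=
  ∀ (K : Type) [Field K] [NumberField K] (n : ℕ) (hcpt : Literature.NumberTheory.Automorphic.isCompact_glFiniteIntegralLevel n K), 0 < n → ∀ (π : Literature.NumberTheory.Automorphic.CuspidalAutomorphicRepData n K hcpt), π.1.IsLAlgebraic → ¬ (n = 2 ∧ ∃ (h₀ : Literature.NumberTheory.Automorphic.isCompact_glFiniteIntegralLevel 2 ℚ) (π₀ : Literature.NumberTheory.Automorphic.CuspidalAutomorphicRepData 2 ℚ h₀) (h₁ : Literature.NumberTheory.Automorphic.isCompact_glFiniteIntegralLevel 1 K) (χ : Literature.NumberTheory.Automorphic.AutomorphicRepData (Literature.NumberTheory.Automorphic.AutomorphyDatum.gl 1 K h₁)), π₀.1.HasArchParameter (fun _ => ({0, 0} : Multiset ℂ)) ∧ (∀ φ ∈ π₀.1.W, Literature.NumberTheory.Automorphic.rightTranslation (Literature.NumberTheory.Automorphic.AdelicGroupData.gl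 2 ℚ) ((Literature.NumberTheory.Automorphic.AutomorphyDatum.gl 2 ℚ h₀).ofArch ⟨-1, trivial⟩) φ - φ ∈ π₀.1.W') ∧ χ.IsLAlgebraic ∧ ∀ᶠ w : IsDedekindDomain.HeightOneSpectrum (NumberField.RingOfIntegers K) in Filter.cofinite, ∀ (u : IsDedekindDomain.HeightOneSpectrum (NumberField.RingOfIntegers ℚ)) (α : Multiset ℂ) (c : ℂ), w.asIdeal.under (NumberField.RingOfIntegers ℚ) = u.asIdeal → π₀.1.HasSatakeParamAt u α → χ.HasSatakeParamAt w {c} → π.1.HasSatakeParamAt w ((α.map (· ^ w.asIdeal.inertiaDeg (NumberField.RingOfIntegers ℚ))).map (c * ·))) → ¬ (n = 2 ∧ ∃ (K₀ : Type) (_ : Field K₀) (_ : NumberField K₀) (_ : Algebra K₀ K), NumberField.IsTotallyReal K₀ ∧ ∃ (h₀ : Literature.NumberTheory.Automorphic.isCompact_glFiniteIntegralLevel 2 K₀) (π₀ : Literature.NumberTheory.Automorphic.CuspidalAutomorphicRepData 2 K₀ h₀) (k : (K₀ →+* ℂ) → ℕ) (w : ℤ) (h₁ : Literature.NumberTheory.Automorphic.isCompact_glFiniteIntegralLevel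 1 K) (χ : Literature.NumberTheory.Automorphic.AutomorphicRepData (Literature.NumberTheory.Automorphic.AutomorphyDatum.gl 1 K h₁)), π₀.1.IsLAlgebraic ∧ π₀.1.HasInfinityType (Literature.NumberTheory.Automorphic.hilbertInfinityType k w) ∧ (∀ (u : NumberField.InfinitePlace K₀), ∀ φ ∈ π₀.1.W, Literature.NumberTheory.Automorphic.rightTranslation (Literature.NumberTheory.Automorphic.AdelicGroupData.gl 2 K₀) (Matrix.GeneralLinearGroup.scalar (Fin 2) (Units.map (MonoidHom.inl (NumberField.InfiniteAdeleRing K₀) (IsDedekindDomain.FiniteAdeleRing (NumberField.RingOfIntegers K₀) K₀) : NumberField.InfiniteAdeleRing K₀ →* NumberField.AdeleRing (NumberField.RingOfIntegers K₀) K₀) (Units.map (MonoidHom.mulSingle (fun u' : NumberField.InfinitePlace K₀ => u'.Completion) u : u.Completion →* NumberField.InfiniteAdeleRing K₀) (-1)))) φ + φ ∈ π₀.1.W') ∧ (∃ β : K₀ →+* ℂ, k β = 1) ∧ χ.IsLAlgebraic ∧ ∀ᶠ w : IsDedekindDomain.HeightOneSpectrum (NumberField.RingOfIntegers K) in Filter.cofinite,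 ∀ (u : IsDedekindDomain.HeightOneSpectrum (NumberField.RingOfIntegers K₀)) (α : Multiset ℂ) (c : ℂ), w.asIdeal.under (NumberField.RingOfIntegers K₀) = u.asIdeal → π₀.1.HasSatakeParamAt u α → χ.HasSatakeParamAt w {c} → π.1.HasSatakeParamAt w ((α.map (· ^ w.asIdeal.inertiaDeg (NumberField.RingOfIntegers K₀))).map (c * ·))) → (n = 2 ∧ ∃ (K₀ : Type) (_ : Field K₀) (_ : NumberField K₀) (_ : Algebra K₀ K), NumberField.IsTotallyReal K₀ ∧ ∃ (h₀ : Literature.NumberTheory.Automorphic.isCompact_glFiniteIntegralLevel 2 K₀) (π₀ : Literature.NumberTheory.Automorphic.CuspidalAutomorphicRepData 2 K₀ h₀) (k : (K₀ →+* ℂ) → ℕ) (w : ℤ) (h₁ : Literature.NumberTheory.Automorphic.isCompact_glFiniteIntegralLevel 1 K) (χ : Literature.NumberTheory.Automorphic.AutomorphicRepData (Literature.NumberTheory.Automorphic.AutomorphyDatum.gl 1 K h₁)), π₀.1.IsLAlgebraic ∧ π₀.1.HasInfinityType (Literature.NumberTheory.Automorphic.hilbertInfinityType k w) ∧ (∃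 β : K₀ →+* ℂ, k β = 1) ∧ χ.IsLAlgebraic ∧ ∀ᶠ w : IsDedekindDomain.HeightOneSpectrum (NumberField.RingOfIntegers K) in Filter.cofinite, ∀ (u : IsDedekindDomain.HeightOneSpectrum (NumberField.RingOfIntegers K₀)) (α : Multiset ℂ) (c : ℂ), w.asIdeal.under (NumberField.RingOfIntegers K₀) = u.asIdeal → π₀.1.HasSatakeParamAt u α → χ.HasSatakeParamAt w {c} → π.1.HasSatakeParamAt w ((α.map (· ^ w.asIdeal.inertiaDeg (NumberField.RingOfIntegers K₀))).map (c * ·))) → ¬ (∃ (χ : Literature.NumberTheory.GaloisRepresentations.HeckeCharacter K) (M : Type) (_ : Field M) (_ : NumberField M) (_ : Algebra K M) (ψ₁ ψ₂ : Literature.NumberTheory.GaloisRepresentations.HeckeCharacter M), IsGalois K M ∧ IsSolvable (M ≃ₐ[K] M) ∧ χ.IsAlgebraic ∧ ψ₁.IsFiniteOrder ∧ ψ₂.IsFiniteOrder ∧ ∀ᶠ Q : IsDedekindDomain.HeightOneSpectrum (NumberField.RingOfIntegers M) in cofinite, ∀ (v : IsDedekindDomain.HeightOneSpectrum (NumberField.RingOfIntegers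 K)) (α : Multiset ℂ), Q.asIdeal.under (NumberField.RingOfIntegers K) = v.asIdeal → π.1.HasSatakeParamAt v α → (α.map (χ.valueAtUniformizer v * ·)).map (· ^ Q.asIdeal.inertiaDeg (NumberField.RingOfIntegers K)) = {ψ₁.valueAtUniformizer Q, ψ₂.valueAtUniformizer Q}) → ¬ (∀ S : (∀ (K : Type) [Field K] [NumberField K] (n : ℕ) (hcpt : Literature.NumberTheory.Automorphic.isCompact_glFiniteIntegralLevel n K), Literature.NumberTheory.Automorphic.AutomorphicRepData (Literature.NumberTheory.Automorphic.AutomorphyDatum.gl n K hcpt) → Prop), ((∀ (K : Type) [Field K] [NumberField K] (n : ℕ) (hcpt : Literature.NumberTheory.Automorphic.isCompact_glFiniteIntegralLevel n K) (π : Literature.NumberTheory.Automorphic.CuspidalAutomorphicRepData n K hcpt), 0 < n → π.1.IsLAlgebraic → (∃ (K₀ : Type) (_ : Field K₀) (_ : NumberField K₀) (_ : Algebra K₀ K), IsGalois K₀ K ∧ IsCyclic (K ≃ₐ[K₀] K) ∧ (NumberField.IsTotallyReal K₀ ∨ NumberField.IsCMField K₀) ∧ ∃ T : Literature.NumberTheory.Automorphic.InfinityType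 K n, π.1.HasInfinityType T ∧ (Literature.NumberTheory.Automorphic.InfinityType.automorphicInduction K₀ (n * Module.finrank K₀ K) T).IsRegular) → S K n hcpt π.1) ∧ (∀ (K₀ : Type) [Field K₀] [NumberField K₀] (M : Type) [Field M] [NumberField M] [Algebra K₀ M] (n : ℕ) (h₀ : Literature.NumberTheory.Automorphic.isCompact_glFiniteIntegralLevel n K₀) (hM : Literature.NumberTheory.Automorphic.isCompact_glFiniteIntegralLevel n M) (h₁ : Literature.NumberTheory.Automorphic.isCompact_glFiniteIntegralLevel 1 M) (π₀ : Literature.NumberTheory.Automorphic.CuspidalAutomorphicRepData n K₀ h₀) (χ : Literature.NumberTheory.Automorphic.AutomorphicRepData (Literature.NumberTheory.Automorphic.AutomorphyDatum.gl 1 M h₁)) (P : Literature.NumberTheory.Automorphic.AutomorphicRepData (Literature.NumberTheory.Automorphic.AutomorphyDatum.gl n M hM)), π₀.1.IsLAlgebraic → χ.IsLAlgebraic → (∀ᶠ w : IsDedekindDomain.HeightOneSpectrum (NumberField.RingOfIntegers M) in cofinite, ∀ (u : IsDedekindDomain.HeightOneSpectrum (NumberField.RingOfIntegers K₀)) (α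 : Multiset ℂ) (c : ℂ), w.asIdeal.under (NumberField.RingOfIntegers K₀) = u.asIdeal → π₀.1.HasSatakeParamAt u α → χ.HasSatakeParamAt w {c} → P.HasSatakeParamAt w ((α.map (· ^ w.asIdeal.inertiaDeg (NumberField.RingOfIntegers K₀))).map (c * ·))) → S K₀ n h₀ π₀.1 → S M n hM P) ∧ (∀ (K : Type) [Field K] [NumberField K] (L : Type) [Field L] [NumberField L] [Algebra K L] (m n : ℕ) (hL : Literature.NumberTheory.Automorphic.isCompact_glFiniteIntegralLevel m L) (hcpt : Literature.NumberTheory.Automorphic.isCompact_glFiniteIntegralLevel n K) (σ : Literature.NumberTheory.Automorphic.CuspidalAutomorphicRepData m L hL) (π : Literature.NumberTheory.Automorphic.AutomorphicRepData (Literature.NumberTheory.Automorphic.AutomorphyDatum.gl n K hcpt)), 0 < m → σ.1.IsLAlgebraic → (∀ᶠ v : IsDedekindDomain.HeightOneSpectrum (NumberField.RingOfIntegers K) in cofinite, ∀ β : IsDedekindDomain.HeightOneSpectrum (NumberField.RingOfIntegers L) → Multiset ℂ, (∀ w : IsDedekindDomain.HeightOneSpectrum (NumberField.RingOfIntegers L),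 w.asIdeal.under (NumberField.RingOfIntegers K) = v.asIdeal → σ.1.HasSatakeParamAt w (β w)) → ∃ α : Multiset ℂ, π.HasSatakeParamAt v α ∧ Literature.NumberTheory.Automorphic.satakePolynomial α = ∏ᶠ w ∈ {w : IsDedekindDomain.HeightOneSpectrum (NumberField.RingOfIntegers L) | w.asIdeal.under (NumberField.RingOfIntegers K) = v.asIdeal}, (Literature.NumberTheory.Automorphic.satakePolynomial (β w)).comp (Polynomial.X ^ w.asIdeal.inertiaDeg (NumberField.RingOfIntegers K))) → S L m hL σ.1 → S K n hcpt π)) → S K n hcpt π.1) → (∀ S : (∀ (K : Type) [Field K] [NumberField K] (n : ℕ) (hcpt : Literature.NumberTheory.Automorphic.isCompact_glFiniteIntegralLevel n K), Literature.NumberTheory.Automorphic.AutomorphicRepData (Literature.NumberTheory.Automorphic.AutomorphyDatum.gl n K hcpt) → Prop), ((∀ (K : Type) [Field K] [NumberField K] (n : ℕ) (hcpt : Literature.NumberTheory.Automorphic.isCompact_glFiniteIntegralLevel n K) (π : Literature.NumberTheory.Automorphic.CuspidalAutomorphicRepData n K hcpt), 0 < n → π.1.IsLAlgebraic → (∃ (K₀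 : Type) (_ : Field K₀) (_ : NumberField K₀) (_ : Algebra K₀ K), IsGalois K₀ K ∧ IsCyclic (K ≃ₐ[K₀] K) ∧ (NumberField.IsTotallyReal K₀ ∨ NumberField.IsCMField K₀) ∧ ∃ T : Literature.NumberTheory.Automorphic.InfinityType K n, π.1.HasInfinityType T ∧ (Literature.NumberTheory.Automorphic.InfinityType.automorphicInduction K₀ (n * Module.finrank K₀ K) T).IsWeaklyRegular) → S K n hcpt π.1) ∧ (∀ (K₀ : Type) [Field K₀] [NumberField K₀] (M : Type) [Field M] [NumberField M] [Algebra K₀ M] (n : ℕ) (h₀ : Literature.NumberTheory.Automorphic.isCompact_glFiniteIntegralLevel n K₀) (hM : Literature.NumberTheory.Automorphic.isCompact_glFiniteIntegralLevel n M) (h₁ : Literature.NumberTheory.Automorphic.isCompact_glFiniteIntegralLevel 1 M) (π₀ : Literature.NumberTheory.Automorphic.CuspidalAutomorphicRepData n K₀ h₀) (χ : Literature.NumberTheory.Automorphic.AutomorphicRepData (Literature.NumberTheory.Automorphic.AutomorphyDatum.gl 1 M h₁)) (P : Literature.NumberTheory.Automorphic.AutomorphicRepData (Literature.NumberTheory.Automorphic.AutomorphyDatum.gl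 n M hM)), π₀.1.IsLAlgebraic → χ.IsLAlgebraic → (∀ᶠ w : IsDedekindDomain.HeightOneSpectrum (NumberField.RingOfIntegers M) in cofinite, ∀ (u : IsDedekindDomain.HeightOneSpectrum (NumberField.RingOfIntegers K₀)) (α : Multiset ℂ) (c : ℂ), w.asIdeal.under (NumberField.RingOfIntegers K₀) = u.asIdeal → π₀.1.HasSatakeParamAt u α → χ.HasSatakeParamAt w {c} → P.HasSatakeParamAt w ((α.map (· ^ w.asIdeal.inertiaDeg (NumberField.RingOfIntegers K₀))).map (c * ·))) → S K₀ n h₀ π₀.1 → S M n hM P) ∧ (∀ (K : Type) [Field K] [NumberField K] (L : Type) [Field L] [NumberField L] [Algebra K L] (m n : ℕ) (hL : Literature.NumberTheory.Automorphic.isCompact_glFiniteIntegralLevel m L) (hcpt : Literature.NumberTheory.Automorphic.isCompact_glFiniteIntegralLevel n K) (σ : Literature.NumberTheory.Automorphic.CuspidalAutomorphicRepData m L hL) (π : Literature.NumberTheory.Automorphic.AutomorphicRepData (Literature.NumberTheory.Automorphic.AutomorphyDatum.gl n K hcpt)), 0 < m → σ.1.IsLAlgebraic → (∀ᶠ v :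 IsDedekindDomain.HeightOneSpectrum (NumberField.RingOfIntegers K) in cofinite, ∀ β : IsDedekindDomain.HeightOneSpectrum (NumberField.RingOfIntegers L) → Multiset ℂ, (∀ w : IsDedekindDomain.HeightOneSpectrum (NumberField.RingOfIntegers L), w.asIdeal.under (NumberField.RingOfIntegers K) = v.asIdeal → σ.1.HasSatakeParamAt w (β w)) → ∃ α : Multiset ℂ, π.HasSatakeParamAt v α ∧ Literature.NumberTheory.Automorphic.satakePolynomial α = ∏ᶠ w ∈ {w : IsDedekindDomain.HeightOneSpectrum (NumberField.RingOfIntegers L) | w.asIdeal.under (NumberField.RingOfIntegers K) = v.asIdeal}, (Literature.NumberTheory.Automorphic.satakePolynomial (β w)).comp (Polynomial.X ^ w.asIdeal.inertiaDeg (NumberField.RingOfIntegers K))) → S L m hL σ.1 → S K n hcpt π)) → S K n hcpt π.1) → ∀ (ℓ : ℕ) [Fact ℓ.Prime] (ι : PadicAlgCl ℓ ≃+* ℂ), ∃ ρ : Literature.NumberTheory.GaloisRepresentations.FramedGaloisRep K (PadicAlgCl ℓ) n, ρ.toGaloisRep.IsSemisimple ∧ ∀ᶠ v : IsDedekindDomain.HeightOneSpectrum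 (NumberField.RingOfIntegers K) in Filter.cofinite, SatakeFrobCompatibleAt ι π.1 ρ v

/-- Assembly (rank 1) — the curried deciding implication of the REFINING child: SOLV → INSOL → MIX (the parent piece by name). -/
def Assembly : Prop :=
  SolvableArtinTypeAvatars → NonSolvableTypeSeedAvatars → Summit.Langlands.Langlands.Theses.SeedParityLadder.MaassTypeSeedAvatars

/-! ## §3 Ladder bookkeeping: the generic rung `DegRung d` = MIX on members with a dial witness of degree ≤ d (dial by name) -/

/-- `DegRung d`: MIX restricted to `SolvableArtinTypeUpToTwistLE d` (g(π) ≤ d). -/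
def DegRung (d : ℕ) : Prop :=
  ∀ (K : Type) [Field K] [NumberField K] (n : ℕ) (hcpt : Literature.NumberTheory.Automorphic.isCompact_glFiniteIntegralLevel n K), 0 < n → ∀ (π : Literature.NumberTheory.Automorphic.CuspidalAutomorphicRepData n K hcpt), π.1.IsLAlgebraic → ¬ (n = 2 ∧ ∃ (h₀ : Literature.NumberTheory.Automorphic.isCompact_glFiniteIntegralLevel 2 ℚ) (π₀ : Literature.NumberTheory.Automorphic.CuspidalAutomorphicRepData 2 ℚ h₀) (h₁ : Literature.NumberTheory.Automorphic.isCompact_glFiniteIntegralLevel 1 K) (χ : Literature.NumberTheory.Automorphic.AutomorphicRepData (Literature.NumberTheory.Automorphic.AutomorphyDatum.gl 1 K h₁)), π₀.1.HasArchParameter (fun _ => ({0, 0} : Multiset ℂ)) ∧ (∀ φ ∈ π₀.1.W, Literature.NumberTheory.Automorphic.rightTranslation (Literature.NumberTheory.Automorphic.AdelicGroupData.gl 2 ℚ) ((Literature.NumberTheory.Automorphic.AutomorphyDatum.gl 2 ℚ h₀).ofArch ⟨-1, trivial⟩) φ - φ ∈ π₀.1.W') ∧ χ.IsLAlgebraic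 ∧ ∀ᶠ w : IsDedekindDomain.HeightOneSpectrum (NumberField.RingOfIntegers K) in Filter.cofinite, ∀ (u : IsDedekindDomain.HeightOneSpectrum (NumberField.RingOfIntegers ℚ)) (α : Multiset ℂ) (c : ℂ), w.asIdeal.under (NumberField.RingOfIntegers ℚ) = u.asIdeal → π₀.1.HasSatakeParamAt u α → χ.HasSatakeParamAt w {c} → π.1.HasSatakeParamAt w ((α.map (· ^ w.asIdeal.inertiaDeg (NumberField.RingOfIntegers ℚ))).map (c * ·))) → ¬ (n = 2 ∧ ∃ (K₀ : Type) (_ : Field K₀) (_ : NumberField K₀) (_ : Algebra K₀ K), NumberField.IsTotallyReal K₀ ∧ ∃ (h₀ : Literature.NumberTheory.Automorphic.isCompact_glFiniteIntegralLevel 2 K₀) (π₀ : Literature.NumberTheory.Automorphic.CuspidalAutomorphicRepData 2 K₀ h₀) (k : (K₀ →+* ℂ) → ℕ) (w : ℤ) (h₁ : Literature.NumberTheory.Automorphic.isCompact_glFiniteIntegralLevel 1 K) (χ : Literature.NumberTheory.Automorphic.AutomorphicRepData (Literature.NumberTheory.Automorphic.AutomorphyDatum.gl 1 K h₁)), π₀.1.IsLAlgebraic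 ∧ π₀.1.HasInfinityType (Literature.NumberTheory.Automorphic.hilbertInfinityType k w) ∧ (∀ (u : NumberField.InfinitePlace K₀), ∀ φ ∈ π₀.1.W, Literature.NumberTheory.Automorphic.rightTranslation (Literature.NumberTheory.Automorphic.AdelicGroupData.gl 2 K₀) (Matrix.GeneralLinearGroup.scalar (Fin 2) (Units.map (MonoidHom.inl (NumberField.InfiniteAdeleRing K₀) (IsDedekindDomain.FiniteAdeleRing (NumberField.RingOfIntegers K₀) K₀) : NumberField.InfiniteAdeleRing K₀ →* NumberField.AdeleRing (NumberField.RingOfIntegers K₀) K₀) (Units.map (MonoidHom.mulSingle (fun u' : NumberField.InfinitePlace K₀ => u'.Completion) u : u.Completion →* NumberField.InfiniteAdeleRing K₀) (-1)))) φ + φ ∈ π₀.1.W') ∧ (∃ β : K₀ →+* ℂ, k β = 1) ∧ χ.IsLAlgebraic ∧ ∀ᶠ w : IsDedekindDomain.HeightOneSpectrum (NumberField.RingOfIntegers K) in Filter.cofinite, ∀ (u : IsDedekindDomain.HeightOneSpectrum (NumberField.RingOfIntegers K₀)) (α : Multiset ℂ) (c : ℂ), w.asIdeal.under (NumberField.RingOfIntegers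 K₀) = u.asIdeal → π₀.1.HasSatakeParamAt u α → χ.HasSatakeParamAt w {c} → π.1.HasSatakeParamAt w ((α.map (· ^ w.asIdeal.inertiaDeg (NumberField.RingOfIntegers K₀))).map (c * ·))) → (n = 2 ∧ ∃ (K₀ : Type) (_ : Field K₀) (_ : NumberField K₀) (_ : Algebra K₀ K), NumberField.IsTotallyReal K₀ ∧ ∃ (h₀ : Literature.NumberTheory.Automorphic.isCompact_glFiniteIntegralLevel 2 K₀) (π₀ : Literature.NumberTheory.Automorphic.CuspidalAutomorphicRepData 2 K₀ h₀) (k : (K₀ →+* ℂ) → ℕ) (w : ℤ) (h₁ : Literature.NumberTheory.Automorphic.isCompact_glFiniteIntegralLevel 1 K) (χ : Literature.NumberTheory.Automorphic.AutomorphicRepData (Literature.NumberTheory.Automorphic.AutomorphyDatum.gl 1 K h₁)), π₀.1.IsLAlgebraic ∧ π₀.1.HasInfinityType (Literature.NumberTheory.Automorphic.hilbertInfinityType k w) ∧ (∃ β : K₀ →+* ℂ, k β = 1) ∧ χ.IsLAlgebraic ∧ ∀ᶠ w : IsDedekindDomain.HeightOneSpectrum (NumberField.RingOfIntegers K) in Filter.cofinite,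 ∀ (u : IsDedekindDomain.HeightOneSpectrum (NumberField.RingOfIntegers K₀)) (α : Multiset ℂ) (c : ℂ), w.asIdeal.under (NumberField.RingOfIntegers K₀) = u.asIdeal → π₀.1.HasSatakeParamAt u α → χ.HasSatakeParamAt w {c} → π.1.HasSatakeParamAt w ((α.map (· ^ w.asIdeal.inertiaDeg (NumberField.RingOfIntegers K₀))).map (c * ·))) → SolvableArtinTypeUpToTwistLE d K n hcpt π.1 → ¬ (∀ S : (∀ (K : Type) [Field K] [NumberField K] (n : ℕ) (hcpt : Literature.NumberTheory.Automorphic.isCompact_glFiniteIntegralLevel n K), Literature.NumberTheory.Automorphic.AutomorphicRepData (Literature.NumberTheory.Automorphic.AutomorphyDatum.gl n K hcpt) → Prop), ((∀ (K : Type) [Field K] [NumberField K] (n : ℕ) (hcpt : Literature.NumberTheory.Automorphic.isCompact_glFiniteIntegralLevel n K) (π : Literature.NumberTheory.Automorphic.CuspidalAutomorphicRepData n K hcpt), 0 < n → π.1.IsLAlgebraic → (∃ (K₀ : Type) (_ : Field K₀) (_ : NumberField K₀) (_ : Algebra K₀ K), IsGalois K₀ K ∧ IsCyclic (K ≃ₐ[K₀]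 K) ∧ (NumberField.IsTotallyReal K₀ ∨ NumberField.IsCMField K₀) ∧ ∃ T : Literature.NumberTheory.Automorphic.InfinityType K n, π.1.HasInfinityType T ∧ (Literature.NumberTheory.Automorphic.InfinityType.automorphicInduction K₀ (n * Module.finrank K₀ K) T).IsRegular) → S K n hcpt π.1) ∧ (∀ (K₀ : Type) [Field K₀] [NumberField K₀] (M : Type) [Field M] [NumberField M] [Algebra K₀ M] (n : ℕ) (h₀ : Literature.NumberTheory.Automorphic.isCompact_glFiniteIntegralLevel n K₀) (hM : Literature.NumberTheory.Automorphic.isCompact_glFiniteIntegralLevel n M) (h₁ : Literature.NumberTheory.Automorphic.isCompact_glFiniteIntegralLevel 1 M) (π₀ : Literature.NumberTheory.Automorphic.CuspidalAutomorphicRepData n K₀ h₀) (χ : Literature.NumberTheory.Automorphic.AutomorphicRepData (Literature.NumberTheory.Automorphic.AutomorphyDatum.gl 1 M h₁)) (P : Literature.NumberTheory.Automorphic.AutomorphicRepData (Literature.NumberTheory.Automorphic.AutomorphyDatum.gl n M hM)), π₀.1.IsLAlgebraic → χ.IsLAlgebraic → (∀ᶠ w : IsDedekindDomain.HeightOneSpectrum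 (NumberField.RingOfIntegers M) in cofinite, ∀ (u : IsDedekindDomain.HeightOneSpectrum (NumberField.RingOfIntegers K₀)) (α : Multiset ℂ) (c : ℂ), w.asIdeal.under (NumberField.RingOfIntegers K₀) = u.asIdeal → π₀.1.HasSatakeParamAt u α → χ.HasSatakeParamAt w {c} → P.HasSatakeParamAt w ((α.map (· ^ w.asIdeal.inertiaDeg (NumberField.RingOfIntegers K₀))).map (c * ·))) → S K₀ n h₀ π₀.1 → S M n hM P) ∧ (∀ (K : Type) [Field K] [NumberField K] (L : Type) [Field L] [NumberField L] [Algebra K L] (m n : ℕ) (hL : Literature.NumberTheory.Automorphic.isCompact_glFiniteIntegralLevel m L) (hcpt : Literature.NumberTheory.Automorphic.isCompact_glFiniteIntegralLevel n K) (σ : Literature.NumberTheory.Automorphic.CuspidalAutomorphicRepData m L hL) (π : Literature.NumberTheory.Automorphic.AutomorphicRepData (Literature.NumberTheory.Automorphic.AutomorphyDatum.gl n K hcpt)), 0 < m → σ.1.IsLAlgebraic → (∀ᶠ v : IsDedekindDomain.HeightOneSpectrum (NumberField.RingOfIntegers K) in cofinite, ∀ β : IsDedekindDomain.HeightOneSpectrum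 (NumberField.RingOfIntegers L) → Multiset ℂ, (∀ w : IsDedekindDomain.HeightOneSpectrum (NumberField.RingOfIntegers L), w.asIdeal.under (NumberField.RingOfIntegers K) = v.asIdeal → σ.1.HasSatakeParamAt w (β w)) → ∃ α : Multiset ℂ, π.HasSatakeParamAt v α ∧ Literature.NumberTheory.Automorphic.satakePolynomial α = ∏ᶠ w ∈ {w : IsDedekindDomain.HeightOneSpectrum (NumberField.RingOfIntegers L) | w.asIdeal.under (NumberField.RingOfIntegers K) = v.asIdeal}, (Literature.NumberTheory.Automorphic.satakePolynomial (β w)).comp (Polynomial.X ^ w.asIdeal.inertiaDeg (NumberField.RingOfIntegers K))) → S L m hL σ.1 → S K n hcpt π)) → S K n hcpt π.1) → (∀ S : (∀ (K : Type) [Field K] [NumberField K] (n : ℕ) (hcpt : Literature.NumberTheory.Automorphic.isCompact_glFiniteIntegralLevel n K), Literature.NumberTheory.Automorphic.AutomorphicRepData (Literature.NumberTheory.Automorphic.AutomorphyDatum.gl n K hcpt) → Prop), ((∀ (K : Type) [Field K] [NumberField K] (n : ℕ) (hcpt : Literature.NumberTheory.Automorphic.isCompact_glFiniteIntegralLevel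 n K) (π : Literature.NumberTheory.Automorphic.CuspidalAutomorphicRepData n K hcpt), 0 < n → π.1.IsLAlgebraic → (∃ (K₀ : Type) (_ : Field K₀) (_ : NumberField K₀) (_ : Algebra K₀ K), IsGalois K₀ K ∧ IsCyclic (K ≃ₐ[K₀] K) ∧ (NumberField.IsTotallyReal K₀ ∨ NumberField.IsCMField K₀) ∧ ∃ T : Literature.NumberTheory.Automorphic.InfinityType K n, π.1.HasInfinityType T ∧ (Literature.NumberTheory.Automorphic.InfinityType.automorphicInduction K₀ (n * Module.finrank K₀ K) T).IsWeaklyRegular) → S K n hcpt π.1) ∧ (∀ (K₀ : Type) [Field K₀] [NumberField K₀] (M : Type) [Field M] [NumberField M] [Algebra K₀ M] (n : ℕ) (h₀ : Literature.NumberTheory.Automorphic.isCompact_glFiniteIntegralLevel n K₀) (hM : Literature.NumberTheory.Automorphic.isCompact_glFiniteIntegralLevel n M) (h₁ : Literature.NumberTheory.Automorphic.isCompact_glFiniteIntegralLevel 1 M) (π₀ : Literature.NumberTheory.Automorphic.CuspidalAutomorphicRepData n K₀ h₀) (χ : Literature.NumberTheory.Automorphic.AutomorphicRepData (Literature.NumberTheory.Automorphic.AutomorphyDatum.gl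 1 M h₁)) (P : Literature.NumberTheory.Automorphic.AutomorphicRepData (Literature.NumberTheory.Automorphic.AutomorphyDatum.gl n M hM)), π₀.1.IsLAlgebraic → χ.IsLAlgebraic → (∀ᶠ w : IsDedekindDomain.HeightOneSpectrum (NumberField.RingOfIntegers M) in cofinite, ∀ (u : IsDedekindDomain.HeightOneSpectrum (NumberField.RingOfIntegers K₀)) (α : Multiset ℂ) (c : ℂ), w.asIdeal.under (NumberField.RingOfIntegers K₀) = u.asIdeal → π₀.1.HasSatakeParamAt u α → χ.HasSatakeParamAt w {c} → P.HasSatakeParamAt w ((α.map (· ^ w.asIdeal.inertiaDeg (NumberField.RingOfIntegers K₀))).map (c * ·))) → S K₀ n h₀ π₀.1 → S M n hM P) ∧ (∀ (K : Type) [Field K] [NumberField K] (L : Type) [Field L] [NumberField L] [Algebra K L] (m n : ℕ) (hL : Literature.NumberTheory.Automorphic.isCompact_glFiniteIntegralLevel m L) (hcpt : Literature.NumberTheory.Automorphic.isCompact_glFiniteIntegralLevel n K) (σ : Literature.NumberTheory.Automorphic.CuspidalAutomorphicRepData m L hL) (π : Literature.NumberTheory.Automorphic.AutomorphicRepData (Literature.NumberTheory.Automorphic.AutomorphyDatum.gl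 n K hcpt)), 0 < m → σ.1.IsLAlgebraic → (∀ᶠ v : IsDedekindDomain.HeightOneSpectrum (NumberField.RingOfIntegers K) in cofinite, ∀ β : IsDedekindDomain.HeightOneSpectrum (NumberField.RingOfIntegers L) → Multiset ℂ, (∀ w : IsDedekindDomain.HeightOneSpectrum (NumberField.RingOfIntegers L), w.asIdeal.under (NumberField.RingOfIntegers K) = v.asIdeal → σ.1.HasSatakeParamAt w (β w)) → ∃ α : Multiset ℂ, π.HasSatakeParamAt v α ∧ Literature.NumberTheory.Automorphic.satakePolynomial α = ∏ᶠ w ∈ {w : IsDedekindDomain.HeightOneSpectrum (NumberField.RingOfIntegers L) | w.asIdeal.under (NumberField.RingOfIntegers K) = v.asIdeal}, (Literature.NumberTheory.Automorphic.satakePolynomial (β w)).comp (Polynomial.X ^ w.asIdeal.inertiaDeg (NumberField.RingOfIntegers K))) → S L m hL σ.1 → S K n hcpt π)) → S K n hcpt π.1) → ∀ (ℓ : ℕ) [Fact ℓ.Prime] (ι : PadicAlgCl ℓ ≃+* ℂ), ∃ ρ : Literature.NumberTheory.GaloisRepresentations.FramedGaloisRep K (PadicAlgCl ℓ) n, ρ.toGaloisRep.IsSemisimple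 ∧ ∀ᶠ v : IsDedekindDomain.HeightOneSpectrum (NumberField.RingOfIntegers K) in Filter.cofinite, SatakeFrobCompatibleAt ι π.1 ρ v

/-- Rungs are antitone: a higher rung contains the lower ones. -/
theorem degRung_antitone {d d' : ℕ} (hdd : d ≤ d') : DegRung d' → DegRung d := by
  intro h K _ _ n hcpt hn π hL hbox hnh hsb hb h2 h3 ℓ _ ι
  exact h K n hcpt hn π hL hbox hnh hsb (solvableArtinTypeUpToTwistLE_mono hdd hb) h2 h3 ℓ ι

/-- SOLV gives every rung. -/
theorem degRung_of_solvableArtinTypeAvatars (h : SolvableArtinTypeAvatars) (d : ℕ) : DegRung d := by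
  intro K _ _ n hcpt hn π hL hbox hnh hsb hb h2 h3 ℓ _ ι
  exact h K n hcpt hn π hL hbox hnh hsb (solvableArtinTypeUpToTwist_of_le hb) h2 h3 ℓ ι

/-- **SOLV IS «all rungs»** (the filed print cell is the union of the degree ladder; no rung is filed separately — memo rows, not items). -/
theorem solvableArtinTypeAvatars_iff_forall_degRung : SolvableArtinTypeAvatars ↔ ∀ d, DegRung d := by
  constructor
  · exact degRung_of_solvableArtinTypeAvatars
  · intro h K _ _ n hcpt hn π hL hbox hnh hsb hd h2 h3 ℓ _ ι
    obtain ⟨d, hb⟩ := solvableArtinTypeUpToTwist_iff_exists_le.mp hd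
    exact h d K n hcpt hn π hL hbox hnh hsb hb h2 h3 ℓ ι

/-! ## §4 EXACTNESS on the TREE decl and the necessity certificates -/

/-- SOLV ⟸ MIX (restriction). -/
theorem solvableArtinTypeAvatars_of_host (h : Summit.Langlands.Langlands.Theses.SeedParityLadder.MaassTypeSeedAvatars) : SolvableArtinTypeAvatars := by
  intro K _ _ n hcpt hn π hL hbox hnh hsb _ h2 h3 ℓ _ ι
  exact h K n hcpt hn π hL hbox hnh hsb h2 h3 ℓ ι

/-- INSOL ⟸ MIX (restriction). -/
theorem nonSolvableTypeSeedAvatars_of_host (h : Summit.Langlands.Langlands.Theses.SeedParityLadder.MaassTypeSeedAvatars) : NonSolvableTypeSeedAvatars := by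
  intro K _ _ n hcpt hn π hL hbox hnh hsb _ h2 h3 ℓ _ ι
  exact h K n hcpt hn π hL hbox hnh hsb h2 h3 ℓ ι

/-- Every rung ⟸ MIX. -/
theorem degRung_of_host (d : ℕ) (h : Summit.Langlands.Langlands.Theses.SeedParityLadder.MaassTypeSeedAvatars) : DegRung d := by
  intro K _ _ n hcpt hn π hL hbox hnh hsb _ h2 h3 ℓ _ ι
  exact h K n hcpt hn π hL hbox hnh hsb h2 h3 ℓ ι

/-- **The glue**: SOLV → INSOL → MIX (one `by_cases` on the dial). -/
theorem maassTypeSeedAvatars_of_cells (hS : SolvableArtinTypeAvatars) (hI : NonSolvableTypeSeedAvatars) : Summit.Langlands.Langlands.Theses.SeedParityLadder.MaassTypeSeedAvatars := by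
  intro K _ _ n hcpt hn π hL hbox hnh hsb h2 h3 ℓ _ ι
  by_cases hd : SolvableArtinTypeUpToTwist K n hcpt π.1
  · exact hS K n hcpt hn π hL hbox hnh hsb hd h2 h3 ℓ ι
  · exact hI K n hcpt hn π hL hbox hnh hsb hd h2 h3 ℓ ι

/-- The glue in the shape inlined in `childroute.glue.lean` (no dial name: `Classical.em` unified against the pieces' hypotheses). -/
theorem maassTypeSeedAvatars_of_cells' (hS : SolvableArtinTypeAvatars) (hI : NonSolvableTypeSeedAvatars) : Summit.Langlands.Langlands.Theses.SeedParityLadder.MaassTypeSeedAvatars := by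
  intro K _ _ n hcpt hn π hL hbox hnh hsb h2 h3 ℓ _ ι
  exact (Classical.em _).elim (fun hd => hS K n hcpt hn π hL hbox hnh hsb hd h2 h3 ℓ ι) (fun hd => hI K n hcpt hn π hL hbox hnh hsb hd h2 h3 ℓ ι)

/-- **EXACT decomposition on the TREE decl**: MIX ↔ SOLV ∧ INSOL. -/
theorem maassTypeSeedAvatars_iff_cells : Summit.Langlands.Langlands.Theses.SeedParityLadder.MaassTypeSeedAvatars ↔ (SolvableArtinTypeAvatars ∧ NonSolvableTypeSeedAvatars) :=
  ⟨fun h => ⟨solvableArtinTypeAvatars_of_host h, nonSolvableTypeSeedAvatars_of_host h⟩, fun h => maassTypeSeedAvatars_of_cells h.1 h.2⟩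

/-! ## §5 S-implied: pieces ⟸ MIX ⟸ `Langlands` (direction (A) of the summit projected to its Satake clause; NODE file, nothing credited) -/

/-- An irreducible `ℚ̄_ℓ`-representation is semisimple. [folklore] -/
theorem isSemisimple_of_isIrreducible {K : Type} [Field K] {ℓ : ℕ} [Fact ℓ.Prime] {n : ℕ}
    (ρ : FramedGaloisRep K (PadicAlgCl ℓ) n) (h : ρ.toGaloisRep.IsIrreducible) : ρ.toGaloisRep.IsSemisimple := by
  haveI := h
  change ComplementedLattice _
  infer_instance

/-- MIX ⟸ `Langlands` (the summit's clause (A) gives an IRREDUCIBLE Satake-compatible avatar for every L-algebraic cuspidal π; irreducible ⇒ semisimple). -/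
theorem maassTypeSeedAvatars_of_langlands (h : _root_.Langlands) : Summit.Langlands.Langlands.Theses.SeedParityLadder.MaassTypeSeedAvatars := by
  intro K _ _ n hcpt hn π hL _ _ _ _ _ ℓ _ ι
  obtain ⟨⟨Rd⟩, hK⟩ := h K
  obtain ⟨ρ, hirr, -, ⟨hρ, -⟩, -⟩ := (hK Rd n hn hcpt).1 π hL ℓ ι
  exact ⟨ρ, isSemisimple_of_isIrreducible ρ hirr, hρ⟩

/-- SOLV ⟸ Langlands (necessity certificate, via the host MIX). -/
theorem solvableArtinTypeAvatars_of_langlands (h : _root_.Langlands) : SolvableArtinTypeAvatars :=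
  solvableArtinTypeAvatars_of_host (maassTypeSeedAvatars_of_langlands h)
/-- INSOL ⟸ Langlands (necessity certificate, via the host MIX). -/
theorem nonSolvableTypeSeedAvatars_of_langlands (h : _root_.Langlands) : NonSolvableTypeSeedAvatars :=
  nonSolvableTypeSeedAvatars_of_host (maassTypeSeedAvatars_of_langlands h)
/-- Every degree rung ⟸ Langlands. -/
theorem degRung_of_langlands (d : ℕ) (h : _root_.Langlands) : DegRung d :=
  degRung_of_host d (maassTypeSeedAvatars_of_langlands h)

/-! ## §6 The deciding theorems: child (V-R, concludes the parent piece MIX by name) and ROOT (through the TREE `closes` of the two hosts) -/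

/-- **DECIDING THEOREM of the child route** (D-0170 `--refines route-Langlands-SeedParityLadder:MaassTypeSeedAvatars`): the two cells give the parent piece MIX BY NAME. 0 sorry. -/
theorem closes_mix (hS : SolvableArtinTypeAvatars) (hI : NonSolvableTypeSeedAvatars) : Summit.Langlands.Langlands.Theses.SeedParityLadder.MaassTypeSeedAvatars :=
  maassTypeSeedAvatars_of_cells' hS hI

/-- The Assembly item holds outright (it is `closes` curried). -/
theorem assembly_holds : Assembly := closes_mix

/-- **ROOT certificate**: the two cells + the parent's sibling cells HOL (stmt-Langlands-27035), REST (27037) + the grand-host's cells QF 26823, QB 26824, QT 26825 and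
FRAME 26827 give `Langlands` — the TREE theorems `Summit.Langlands.Langlands.Theses.SeedParityLadder.closes` (rev 0) and `Summit.Langlands.Langlands.Theses.QuarterConductorLadder.closes` (rev 0), tree decls only. -/
theorem closes_root (hS : SolvableArtinTypeAvatars) (hI : NonSolvableTypeSeedAvatars)
    (hH : Summit.Langlands.Langlands.Theses.SeedParityLadder.HolomorphicSeedAvatars) (hR : Summit.Langlands.Langlands.Theses.SeedParityLadder.SeedlessBeltAvatars)
    (hF : Summit.Langlands.Langlands.Theses.QuarterConductorLadder.QuarterCensusFloor) (hB : Summit.Langlands.Langlands.Theses.QuarterConductorLadder.QuarterCensusBand) (hT : Summit.Langlands.Langlands.Theses.QuarterConductorLadder.QuarterConductorTail) (hFr : Summit.Langlands.Langlands.Theses.QuarterConductorLadder.WeaklyRegularHullFrame) :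
    _root_.Langlands :=
  Summit.Langlands.Langlands.Theses.QuarterConductorLadder.closes hF hB hT (Summit.Langlands.Langlands.Theses.SeedParityLadder.closes hH (closes_mix hS hI) hR) hFr


/-! ## Bridges to the BORN route `Theses.PolyhedralTypeLadder` (route-Langlands-PolyhedralTypeLadder rev 0): the filed texts are this twin's cells, definitionally -/

/-- The born route decl SOLV (`PolyhedralTypeLadder.SolvableArtinTypeAvatars`, stmt-Langlands-27320) IS this twin's `SolvableArtinTypeAvatars`. -/
theorem solv_route_iff_twin :
    Summit.Langlands.Langlands.Theses.PolyhedralTypeLadder.SolvableArtinTypeAvatars ↔ SolvableArtinTypeAvatars := Iff.rfl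

/-- The born route decl INSOL (`PolyhedralTypeLadder.NonSolvableTypeSeedAvatars`, stmt-Langlands-27321) IS this twin's `NonSolvableTypeSeedAvatars`. -/
theorem insol_route_iff_twin :
    Summit.Langlands.Langlands.Theses.PolyhedralTypeLadder.NonSolvableTypeSeedAvatars ↔ NonSolvableTypeSeedAvatars := Iff.rfl

/-- The born route's Assembly (`PolyhedralTypeLadder.Assembly`, stmt-Langlands-27322) IS this twin's `Assembly`. -/
theorem assembly_route_iff_twin :
    Summit.Langlands.Langlands.Theses.PolyhedralTypeLadder.Assembly ↔ Assembly := Iff.rfl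

/-- EXACTNESS for the born decls: MIX ↔ SOLV ∧ INSOL with the route's own cells. -/
theorem mix_iff_route_cells :
    SeedParityLadder.MaassTypeSeedAvatars ↔
      Summit.Langlands.Langlands.Theses.PolyhedralTypeLadder.SolvableArtinTypeAvatars ∧
        Summit.Langlands.Langlands.Theses.PolyhedralTypeLadder.NonSolvableTypeSeedAvatars :=
  maassTypeSeedAvatars_iff_cells

/-- Necessity for the born decls: the summit implies both cells of the route. -/
theorem route_cells_of_langlands (h : _root_.Langlands) :
    Summit.Langlands.Langlands.Theses.PolyhedralTypeLadder.SolvableArtinTypeAvatars ∧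
      Summit.Langlands.Langlands.Theses.PolyhedralTypeLadder.NonSolvableTypeSeedAvatars :=
  ⟨solvableArtinTypeAvatars_of_langlands h, nonSolvableTypeSeedAvatars_of_langlands h⟩

end Summit.Langlands.Langlands.Theorems.PolyhedralTypeLadderCells
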